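import Mathlib
import Summits.MatrixMultiplication.MatrixMultiplication.Theses.FidelityWitnesses
import Literature.Computability.AlgebraicComplexity.MatMulRankLowerBoundsProofs
import Literature.Computability.AlgebraicComplexity.AlderStrassen
import Literature.Computability.AlgebraicComplexity.AsymptoticRankZariskiClosedProofs
import Summits.MatrixMultiplication.MatrixMultiplication.Theorems.FidelityWitnessesSevenEighthsLawDistance
import Summits.MatrixMultiplication.MatrixMultiplication.Theorems.FidelityWitnessesSixEighthsAtFiveEffectiveKoszul

/-!
# `FidelityWitnesses.SixEighthsAtFive` (stmt-MatrixMultiplication-14040) — effective bound at `(2,5)`, II: `M(2,5) ≤ 31/4`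

Support file for the item `SixEighthsAtFive` (`M(2,5) ≤ 6`: `‖Σ S·⟨2,2,2⟩‖² ≤ 6 Σ‖S‖²` for every
tensor `S` of rank `≤ 5` in the `2 × 2` format).  The sharp constant `6` is open; the tree so far has
only the INEFFECTIVE gap (`FidelityGapTwoSix`, by compactness from `R̲(⟨2,2,2⟩) = 7`).  This file proves,
sorry-free, the first effective constant:

* `sixEighthsAtFive_dist_sq_ge_quarter` — every tensor of rank `≤ 5` lies at Frobenius distance
  `≥ 1/2` from `⟨2,2,2⟩`: `Σ |⟨2,2,2⟩ − S|² ≥ 1/4`;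
* `sixEighthsAtFive_effective` — `‖Σ S·⟨2,2,2⟩‖² ≤ (31/4) · Σ‖S‖²` for `tensorRank S ≤ 5`
  (i.e. `M(2,5) ≤ 7.75`; the item claims `6`, the trivial bound is `8`).

Method: a QUANTITATIVE Koszul flattening (Landsberg–Ottaviani) = the witness paradigm of the route one
rung above the plain flattening (`FlatteningWitness`).  Let `K_Φ = koszulFlattening 1 Φ` be the
`p = 1` Koszul flattening after the Pauli projection `Φ : ℂ^{2×2} → ℂ³`, `X ↦ (x₀₀+x₁₁, x₀₁+x₁₀, x₀₀−x₁₁)`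
(a `12 × 12` matrix, linear in the tensor).
1. `rank K_Φ(S) ≤ C(2,1)·5 = 10 < 12` for `R(S) ≤ 5` (tree: `rank_koszulFlattening_sum_triad_le`), so
   `K_Φ(S) z = 0` for some `z ≠ 0` (rank–nullity);
2. `‖K_Φ(⟨2,2,2⟩) z‖² ≥ ‖z‖²` — an exact sum-of-squares identity (`K†K = 1 + 3P`: the six block rows
   are `b − a, c − b, c + a` on two triples of coordinates, and `|b−a|²+|c−b|²+|c+a|² = |a|²+|b|²+|c|²+|a−b+c|²`);
3. `‖K_Φ(D) z‖² ≤ 4 ‖D‖² ‖z‖²` for every tensor `D` (Cauchy–Schwarz row by row; `‖Φ‖² ≤ 2`);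
4. with `D = ⟨2,2,2⟩ − S`: `‖z‖² ≤ ‖K_Φ(⟨2,2,2⟩) z‖² = ‖K_Φ(D) z‖² ≤ 4‖D‖²‖z‖²`, whence `‖D‖² ≥ 1/4`;
5. the rank-`≤ 5` tensors form a cone, so the distance bound polarises to the fidelity bound
   (as in `SevenEighthsLaw.sevenEighthsLaw_iff_unitBall`).

THIS FILE: the six block rows of `K_Φ(⟨2,2,2⟩) z`, the sum-of-squares identity (step 2), a kernel
vector (step 1), the distance bound (step 4) and the fidelity bound (step 5); the boundedness (step 3)
is `effective_upper_bound` of the prequel `…EffectiveKoszul.lean`.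
No new definitions (the projection is a local notation for an explicit `Matrix.mulVecLin`).
-/

set_option linter.dupNamespace false

namespace Summit.MatrixMultiplication.MatrixMultiplication.Theorems

open scoped BigOperators ComplexConjugate
open Matrix
open Literature.Computability.AlgebraicComplexity

/-- The index type `Fin 2 × Fin 2` of `2 × 2` matrices. -/
local notation "P2" => Fin 2 × Fin 2

set_option quotPrecheck false in
/-- The `3 × 4` Pauli coordinate matrix (rows `I`, `σₓ`, `σ_z`): `Φ X = (x₀₀+x₁₁, x₀₁+x₁₀, x₀₀−x₁₁)`. -/
local notation "pauliMat" => (Matrix.of fun (j : Fin (2 * 1 + 1)) (a : Fin 2 × Fin 2) =>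
    if j = 0 then (if a.1 = a.2 then (1 : ℂ) else 0)
    else if j = 1 then (if a.1 = a.2 then (0 : ℂ) else 1)
    else (if a.1 = a.2 then (if a.1 = 0 then (1 : ℂ) else -1) else 0))

set_option quotPrecheck false in
/-- The Pauli projection `ℂ^{2×2} → ℂ³` as a linear map. -/
local notation "ΦP" => Matrix.mulVecLin pauliMat

set_option quotPrecheck false in
/-- The `p = 1` Koszul flattening after the Pauli projection (a `12 × 12` matrix, linear in the tensor). -/
local notation "KP" => koszulFlattening 1 ΦP

set_option quotPrecheck false in
/-- `⟨2,2,2⟩` over `ℂ`. -/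
local notation "TT" => (matMulTensor ℂ 2 2 2)

/-- The column blocks `{0}, {1}, {2}` (`PSub 3 1`). -/
local notation "S0" => (⟨{0}, by decide⟩ : PSub (2 * 1 + 1) 1)
local notation "S1" => (⟨{1}, by decide⟩ : PSub (2 * 1 + 1) 1)
local notation "S2" => (⟨{2}, by decide⟩ : PSub (2 * 1 + 1) 1)
/-- The row blocks `{0,1}, {0,2}, {1,2}` (`PSub 3 2`). -/
local notation "T01" => (⟨{0, 1}, by decide⟩ : PSub (2 * 1 + 1) (1 + 1))
local notation "T02" => (⟨{0, 2}, by decide⟩ : PSub (2 * 1 + 1) (1 + 1))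
local notation "T12" => (⟨{1, 2}, by decide⟩ : PSub (2 * 1 + 1) (1 + 1))

/-! ## The rows of `K_Φ(⟨2,2,2⟩) z` -/

/-- The inner sum of the row formula for `⟨2,2,2⟩`: only the column `b = (κ, μ)` with matching middle
index survives, and `Φ(e_{κν})_j = pauliMat j (κ,ν)`. [folklore] -/
theorem effective_inner_sum (z : PSub (2 * 1 + 1) 1 × P2 → ℂ) (j : Fin (2 * 1 + 1))
    (S : Finset (Fin (2 * 1 + 1))) (μ ν : Fin 2) :
    (∑ b : P2, (ΦP) (fun a => TT a b (μ, ν)) j * extendPSub z S b) =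
      ∑ κ : Fin 2, (pauliMat) j (κ, ν) * extendPSub z S (κ, μ) := by
  rw [Fintype.sum_prod_type]
  refine Finset.sum_congr rfl fun κ _ => ?_
  rw [Finset.sum_eq_single μ]
  · rw [matMulTensor_slice, if_pos rfl, effective_pauli_single]
  · intro μ' _ hne
    rw [matMulTensor_slice, if_neg hne, map_zero, Pi.zero_apply, zero_mul]
  · intro h; exact absurd (Finset.mem_univ μ) h

/-- Row `({0,1}, (μ, 0))`. [folklore] -/
theorem effective_row01_zero (z : PSub (2 * 1 + 1) 1 × P2 → ℂ) (μ : Fin 2) :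
    (KP TT *ᵥ z) (T01, (μ, 0)) = z (S1, (0, μ)) - z (S0, (1, μ)) := by
  rw [effective_koszulFlattening_mulVec]
  dsimp only
  have e0 : (({0, 1} : Finset (Fin (2 * 1 + 1))).erase 0) = {1} := by decide
  have e1 : (({0, 1} : Finset (Fin (2 * 1 + 1))).erase 1) = {0} := by decide
  have s0 : koszulSign ({1} : Finset (Fin (2 * 1 + 1))) 0 = 1 := by decide
  have s1 : koszulSign ({0} : Finset (Fin (2 * 1 + 1))) 1 = -1 := by decide
  rw [Finset.sum_pair (by decide), e0, e1, s0, s1, effective_inner_sum, effective_inner_sum]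
  simp only [Fin.sum_univ_two, Matrix.of_apply]
  rw [extendPSub_of_card z (by decide), extendPSub_of_card z (by decide),
    extendPSub_of_card z (by decide), extendPSub_of_card z (by decide)]
  push_cast
  simp
  ring


/-- Row `({0, 1}, (μ, 1))`. [folklore] -/
theorem effective_row01_one (z : PSub (2 * 1 + 1) 1 × P2 → ℂ) (μ : Fin 2) :
    (KP TT *ᵥ z) (T01, (μ, 1)) = z (S1, (1, μ)) - z (S0, (0, μ)) := by
  rw [effective_koszulFlattening_mulVec]
  dsimp only
  have e0 : (({0, 1} : Finset (Fin (2 * 1 + 1))).erase 0) = {1} := by decide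
  have e1 : (({0, 1} : Finset (Fin (2 * 1 + 1))).erase 1) = {0} := by decide
  have s0 : koszulSign ({1} : Finset (Fin (2 * 1 + 1))) 0 = 1 := by decide
  have s1 : koszulSign ({0} : Finset (Fin (2 * 1 + 1))) 1 = -1 := by decide
  rw [Finset.sum_pair (by decide), e0, e1, s0, s1, effective_inner_sum, effective_inner_sum]
  simp only [Fin.sum_univ_two, Matrix.of_apply]
  rw [extendPSub_of_card z (by decide), extendPSub_of_card z (by decide),
    extendPSub_of_card z (by decide), extendPSub_of_card z (by decide)]
  push_cast
  simp
  try ring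

/-- Row `({0, 2}, (μ, 0))`. [folklore] -/
theorem effective_row02_zero (z : PSub (2 * 1 + 1) 1 × P2 → ℂ) (μ : Fin 2) :
    (KP TT *ᵥ z) (T02, (μ, 0)) = z (S2, (0, μ)) - z (S0, (0, μ)) := by
  rw [effective_koszulFlattening_mulVec]
  dsimp only
  have e0 : (({0, 2} : Finset (Fin (2 * 1 + 1))).erase 0) = {2} := by decide
  have e1 : (({0, 2} : Finset (Fin (2 * 1 + 1))).erase 2) = {0} := by decide
  have s0 : koszulSign ({2} : Finset (Fin (2 * 1 + 1))) 0 = 1 := by decide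
  have s1 : koszulSign ({0} : Finset (Fin (2 * 1 + 1))) 2 = -1 := by decide
  rw [Finset.sum_pair (by decide), e0, e1, s0, s1, effective_inner_sum, effective_inner_sum]
  simp only [Fin.sum_univ_two, Matrix.of_apply]
  rw [extendPSub_of_card z (by decide), extendPSub_of_card z (by decide),
    extendPSub_of_card z (by decide), extendPSub_of_card z (by decide)]
  push_cast
  simp
  try ring

/-- Row `({0, 2}, (μ, 1))`. [folklore] -/
theorem effective_row02_one (z : PSub (2 * 1 + 1) 1 × P2 → ℂ) (μ : Fin 2) :
    (KP TT *ᵥ z) (T02, (μ, 1)) = z (S2, (1, μ)) + z (S0, (1, μ)) := by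
  rw [effective_koszulFlattening_mulVec]
  dsimp only
  have e0 : (({0, 2} : Finset (Fin (2 * 1 + 1))).erase 0) = {2} := by decide
  have e1 : (({0, 2} : Finset (Fin (2 * 1 + 1))).erase 2) = {0} := by decide
  have s0 : koszulSign ({2} : Finset (Fin (2 * 1 + 1))) 0 = 1 := by decide
  have s1 : koszulSign ({0} : Finset (Fin (2 * 1 + 1))) 2 = -1 := by decide
  rw [Finset.sum_pair (by decide), e0, e1, s0, s1, effective_inner_sum, effective_inner_sum]
  simp only [Fin.sum_univ_two, Matrix.of_apply]
  rw [extendPSub_of_card z (by decide), extendPSub_of_card z (by decide),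
    extendPSub_of_card z (by decide), extendPSub_of_card z (by decide)]
  push_cast
  simp
  try ring

/-- Row `({1, 2}, (μ, 0))`. [folklore] -/
theorem effective_row12_zero (z : PSub (2 * 1 + 1) 1 × P2 → ℂ) (μ : Fin 2) :
    (KP TT *ᵥ z) (T12, (μ, 0)) = z (S2, (1, μ)) - z (S1, (0, μ)) := by
  rw [effective_koszulFlattening_mulVec]
  dsimp only
  have e0 : (({1, 2} : Finset (Fin (2 * 1 + 1))).erase 1) = {2} := by decide
  have e1 : (({1, 2} : Finset (Fin (2 * 1 + 1))).erase 2) = {1} := by decide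
  have s0 : koszulSign ({2} : Finset (Fin (2 * 1 + 1))) 1 = 1 := by decide
  have s1 : koszulSign ({1} : Finset (Fin (2 * 1 + 1))) 2 = -1 := by decide
  rw [Finset.sum_pair (by decide), e0, e1, s0, s1, effective_inner_sum, effective_inner_sum]
  simp only [Fin.sum_univ_two, Matrix.of_apply]
  rw [extendPSub_of_card z (by decide), extendPSub_of_card z (by decide),
    extendPSub_of_card z (by decide), extendPSub_of_card z (by decide)]
  push_cast
  simp
  try ring

/-- Row `({1, 2}, (μ, 1))`. [folklore] -/
theorem effective_row12_one (z : PSub (2 * 1 + 1) 1 × P2 → ℂ) (μ : Fin 2) :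
    (KP TT *ᵥ z) (T12, (μ, 1)) = z (S2, (0, μ)) + z (S1, (1, μ)) := by
  rw [effective_koszulFlattening_mulVec]
  dsimp only
  have e0 : (({1, 2} : Finset (Fin (2 * 1 + 1))).erase 1) = {2} := by decide
  have e1 : (({1, 2} : Finset (Fin (2 * 1 + 1))).erase 2) = {1} := by decide
  have s0 : koszulSign ({2} : Finset (Fin (2 * 1 + 1))) 1 = 1 := by decide
  have s1 : koszulSign ({1} : Finset (Fin (2 * 1 + 1))) 2 = -1 := by decide
  rw [Finset.sum_pair (by decide), e0, e1, s0, s1, effective_inner_sum, effective_inner_sum]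
  simp only [Fin.sum_univ_two, Matrix.of_apply]
  rw [extendPSub_of_card z (by decide), extendPSub_of_card z (by decide),
    extendPSub_of_card z (by decide), extendPSub_of_card z (by decide)]
  push_cast
  simp
  try ring

/-- `|b−a|² + |c−b|² + |c+a|² = |a|² + |b|² + |c|² + |a−b+c|²`. [folklore] -/
theorem effective_sq3 (a b c : ℂ) :
    ‖b - a‖ ^ 2 + ‖c - b‖ ^ 2 + ‖c + a‖ ^ 2 =
      ‖a‖ ^ 2 + ‖b‖ ^ 2 + ‖c‖ ^ 2 + ‖a - b + c‖ ^ 2 := by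
  simp only [Complex.sq_norm, Complex.normSq_apply, Complex.add_re, Complex.add_im,
    Complex.sub_re, Complex.sub_im]
  ring

/-- `|b−a|² + |c−a|² + |c+b|² = |a|² + |b|² + |c|² + |b+c−a|²`. [folklore] -/
theorem effective_sq3' (a b c : ℂ) :
    ‖b - a‖ ^ 2 + ‖c - a‖ ^ 2 + ‖c + b‖ ^ 2 =
      ‖a‖ ^ 2 + ‖b‖ ^ 2 + ‖c‖ ^ 2 + ‖b + c - a‖ ^ 2 := by
  simp only [Complex.sq_norm, Complex.normSq_apply, Complex.add_re, Complex.add_im,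
    Complex.sub_re, Complex.sub_im]
  ring

/-- **Quantitative injectivity of `K_Φ(⟨2,2,2⟩)`**: `‖K_Φ(⟨2,2,2⟩) z‖² ≥ ‖z‖²` (in fact
`K†K = 1 + 3P`; the slack is `Σ_μ |a−b+c|² + |b′+c′−a′|²`). [folklore] -/
theorem effective_lower_bound (z : PSub (2 * 1 + 1) 1 × P2 → ℂ) :
    (∑ q, ‖z q‖ ^ 2) ≤ ∑ r, ‖(KP TT *ᵥ z) r‖ ^ 2 := by
  rw [Fintype.sum_prod_type, Fintype.sum_prod_type, effective_sum_PSub_two, effective_sum_PSub_one]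
  simp only [Fintype.sum_prod_type, Fin.sum_univ_two, effective_row01_zero, effective_row01_one,
    effective_row02_zero, effective_row02_one, effective_row12_zero, effective_row12_one]
  have h1 := fun μ : Fin 2 => effective_sq3 (z (S0, (1, μ))) (z (S1, (0, μ))) (z (S2, (1, μ)))
  have h2 := fun μ : Fin 2 => effective_sq3' (z (S0, (0, μ))) (z (S1, (1, μ))) (z (S2, (0, μ)))
  have p1 := fun μ : Fin 2 => sq_nonneg ‖z (S0, (1, μ)) - z (S1, (0, μ)) + z (S2, (1, μ))‖
  have p2 := fun μ : Fin 2 => sq_nonneg ‖z (S1, (1, μ)) + z (S2, (0, μ)) - z (S0, (0, μ))‖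
  linarith [h1 0, h1 1, h2 0, h2 1, p1 0, p1 1, p2 0, p2 1]


/-! ## A kernel vector, the distance bound, the fidelity bound -/

/-- For `R(S) ≤ 5` the `12 × 12` matrix `K_Φ(S)` has rank `≤ C(2,1) · 5 = 10`
(`rank_koszulFlattening_sum_triad_le`), hence a non-zero kernel vector. [folklore] -/
theorem effective_exists_kernel (S : P2 → P2 → P2 → ℂ) (hS : tensorRank S ≤ 5) :
    ∃ z : PSub (2 * 1 + 1) 1 × P2 → ℂ, z ≠ 0 ∧ KP S *ᵥ z = 0 := by
  obtain ⟨w, u, v, hdec⟩ := exists_eq_sum_triad_of_tensorRank_le hS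
  have hrank : (KP S).rank ≤ 10 := by
    rw [hdec]
    exact (rank_koszulFlattening_sum_triad_le 1 (ΦP) w u v).trans (by norm_num [Nat.choose])
  set M := KP S with hM
  have hcard : Module.finrank ℂ (PSub (2 * 1 + 1) 1 × P2 → ℂ) = 12 := by
    rw [Module.finrank_fintype_fun_eq_card, Fintype.card_prod, card_PSub, Fintype.card_prod,
      Fintype.card_fin]
    rfl
  have hrn := LinearMap.finrank_range_add_finrank_ker M.mulVecLin
  rw [hcard] at hrn
  have hr : Module.finrank ℂ (LinearMap.range M.mulVecLin) ≤ 10 := hrank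
  have hker : 0 < Module.finrank ℂ (LinearMap.ker M.mulVecLin) := by omega
  have hne : LinearMap.ker M.mulVecLin ≠ ⊥ := by
    intro h
    rw [h, finrank_bot] at hker
    exact lt_irrefl _ hker
  obtain ⟨z, hz, hz0⟩ := Submodule.exists_mem_ne_zero_of_ne_bot hne
  exact ⟨z, hz0, by simpa [LinearMap.mem_ker] using hz⟩

/-- **Every tensor of rank `≤ 5` lies at Frobenius distance `≥ 1/2` from `⟨2,2,2⟩`**:
`Σ |⟨2,2,2⟩ − S|² ≥ 1/4` (quantitative Koszul flattening: `‖z‖² ≤ ‖K_Φ(T) z‖² = ‖K_Φ(T−S) z‖² ≤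
4 ‖T−S‖² ‖z‖²` for a kernel vector `z ≠ 0` of `K_Φ(S)`).  The sharp value conjectured by the item is
`2` (Bini's border scheme). [folklore] -/
theorem sixEighthsAtFive_dist_sq_ge_quarter (S : P2 → P2 → P2 → ℂ) (hS : tensorRank S ≤ 5) :
    (1 / 4 : ℝ) ≤ ∑ a, ∑ b, ∑ c, ‖matMulTensor ℂ 2 2 2 a b c - S a b c‖ ^ 2 := by
  obtain ⟨z, hz0, hKz⟩ := effective_exists_kernel S hS
  obtain ⟨D, hD⟩ : ∃ D : P2 → P2 → P2 → ℂ, D = fun a b c => TT a b c - S a b c := ⟨_, rfl⟩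
  have hTD : TT = D + S := by
    rw [hD]
    funext a b c
    simp
  have hK : KP TT *ᵥ z = KP D *ᵥ z := by
    rw [hTD, koszulFlattening_add, Matrix.add_mulVec, hKz, add_zero]
  have hlow : (∑ q, ‖z q‖ ^ 2) ≤ ∑ r, ‖(KP D *ᵥ z) r‖ ^ 2 := by
    have := effective_lower_bound z
    rwa [hK] at this
  have hup : (∑ r, ‖(KP D *ᵥ z) r‖ ^ 2) ≤
      4 * (∑ a, ∑ b, ∑ c, ‖D a b c‖ ^ 2) * ∑ q, ‖z q‖ ^ 2 := effective_upper_bound D z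
  have hzpos : 0 < ∑ q, ‖z q‖ ^ 2 := by
    obtain ⟨q, hq⟩ : ∃ q, z q ≠ 0 := Function.ne_iff.mp hz0
    have hq' : 0 < ‖z q‖ ^ 2 := by positivity
    exact lt_of_lt_of_le hq'
      (Finset.single_le_sum (f := fun q => ‖z q‖ ^ 2) (fun q _ => by positivity) (Finset.mem_univ q))
  have hle : (∑ q, ‖z q‖ ^ 2) ≤ 4 * (∑ a, ∑ b, ∑ c, ‖D a b c‖ ^ 2) * ∑ q, ‖z q‖ ^ 2 :=
    hlow.trans hup
  have h4 : 1 ≤ 4 * ∑ a, ∑ b, ∑ c, ‖D a b c‖ ^ 2 := by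
    by_contra hlt
    have hlt' : 4 * ∑ a, ∑ b, ∑ c, ‖D a b c‖ ^ 2 < 1 := lt_of_not_ge hlt
    nlinarith [mul_lt_mul_of_pos_right hlt' hzpos]
  rw [hD] at h4
  linarith

/-- **The first effective bound at `(2,5)`: `‖Σ S·⟨2,2,2⟩‖² ≤ (31/4) Σ‖S‖²` for `R(S) ≤ 5`**
(`M(2,5) ≤ 7.75`; the item `SixEighthsAtFive` claims the sharp `6`).  The rank-`≤ 5` tensors form a
cone (`tensorRank_smul_le`), so the distance bound `Σ|T − λS|² ≥ 1/4` at `λ = conj(Σ S·T)/‖S‖²`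
(`= 8 − |Σ S·T|²/‖S‖²`) polarises to the fidelity bound. [folklore] -/
theorem sixEighthsAtFive_effective (S : P2 → P2 → P2 → ℂ) (hS : tensorRank S ≤ 5) :
    ‖∑ a, ∑ b, ∑ c, S a b c * matMulTensor ℂ 2 2 2 a b c‖ ^ 2 ≤
      (31 / 4) * ∑ a, ∑ b, ∑ c, ‖S a b c‖ ^ 2 := by
  set N : ℝ := ∑ a, ∑ b, ∑ c, ‖S a b c‖ ^ 2 with hN
  set B : ℂ := ∑ a, ∑ b, ∑ c, S a b c * matMulTensor ℂ 2 2 2 a b c with hBdef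
  have hN0 : 0 ≤ N := by positivity
  rcases hN0.lt_or_eq with hNpos | hN00
  · set lam : ℂ := conj B / (N : ℂ) with hlam
    have key := sixEighthsAtFive_dist_sq_ge_quarter (lam • S) ((tensorRank_smul_le lam S).trans hS)
    rw [SevenEighthsLaw.sevenEighthsLaw_dist_sq_expand] at key
    have hNl : (∑ a, ∑ b, ∑ c, ‖(lam • S) a b c‖ ^ 2) = ‖lam‖ ^ 2 * N := by
      simp only [Pi.smul_apply, smul_eq_mul, norm_mul, mul_pow, hN, Finset.mul_sum]
    have hBl : (∑ a, ∑ b, ∑ c, (lam • S) a b c * matMulTensor ℂ 2 2 2 a b c) = lam * B := by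
      simp only [Pi.smul_apply, smul_eq_mul, hBdef, Finset.mul_sum, mul_assoc]
    rw [hNl, hBl] at key
    have h1 : ‖lam‖ ^ 2 * N = ‖B‖ ^ 2 / N := by
      rw [hlam, norm_div, Complex.norm_conj, Complex.norm_real, Real.norm_of_nonneg hNpos.le]
      field_simp
    have h2 : (lam * B).re = ‖B‖ ^ 2 / N := by
      have : lam * B = ((‖B‖ ^ 2 / N : ℝ) : ℂ) := by
        rw [hlam, div_mul_eq_mul_div, Complex.conj_mul']
        push_cast
        ring
      rw [this, Complex.ofReal_re]
    rw [h1, h2] at key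
    have h3 : ‖B‖ ^ 2 / N ≤ 31 / 4 := by linarith
    rw [div_le_iff₀ hNpos] at h3
    linarith
  · have hS0 : ∀ a b c, S a b c = 0 := by
      intro a b c
      have hsum : (∑ a, ∑ b, ∑ c, ‖S a b c‖ ^ 2) = 0 := hN00.symm
      have ha := (Finset.sum_eq_zero_iff_of_nonneg fun a _ => by positivity).1 hsum a
        (Finset.mem_univ a)
      have hb := (Finset.sum_eq_zero_iff_of_nonneg fun b _ => by positivity).1 ha b
        (Finset.mem_univ b)
      have hc := (Finset.sum_eq_zero_iff_of_nonneg fun c _ => by positivity).1 hb c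
        (Finset.mem_univ c)
      simpa using hc
    have hB0 : B = 0 := by
      rw [hBdef]
      exact Finset.sum_eq_zero fun a _ => Finset.sum_eq_zero fun b _ =>
        Finset.sum_eq_zero fun c _ => by rw [hS0 a b c, zero_mul]
    rw [hB0, ← hN00]
    simp

end Summit.MatrixMultiplication.MatrixMultiplication.Theorems
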